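import Literature.NumberTheory.Automorphic.IdeleClassGroupAutomorphicQuotientProofs
import Literature.NumberTheory.Automorphic.IdelicDyadicUnfolding
import Mathlib.MeasureTheory.Measure.Haar.Unique
import HarnessLib

/-!
# The splitting `𝕀_K = 𝕀_K¹ × ℝ_{>0}` of the idele group and of its Haar measure
(Weil, *Basic Number Theory* (1967), Ch. IV §4, Cor. 2 of Thm. 5; Tate, Ch. XV of Cassels–Fröhlich
(1967), §4.3)

Topic `NumberTheory/Automorphic`; namespace `Literature.NumberTheory.Automorphic`. The idele group of a
number field is the topological direct product of the norm-one ideles `𝕀_K¹ = ker |·|_𝔸`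
(`normOneIdeles`) and the split component `M = ρ(ℝ_{>0})` of diagonal positive real ideles at the
archimedean places (`posRealIdele`): Weil's `k_𝔸ˣ = k_𝔸¹ × M`. The tree has the continuous retraction
`r : 𝕀_K →* 𝕀_K¹`, `r(x) = x θ(x)⁻¹`, `θ(x) = ρ(|x|^{1/[K:ℚ]})` (`IdeleClassGroup.exists_normOneRetraction`,
`IdeleClassGroupAutomorphicQuotientProofs`), used there for the homeomorphism
`𝕀_K ⧸ M Kˣ ≃ 𝕀_K¹ ⧸ Kˣ`. This file records the product decomposition itself and its consequence for
Haar measures, the form in which "integrate over the idele classes = integrate over `ℝ_{>0}` and over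
the compact `𝕀_K¹/Kˣ`" enters the unfolding of Eisenstein series and zeta integrals (Tate, §4.3;
Jacquet–Shalika (1981), §4; Cogdell (2004), §2.3):

* `posRealIdeles K = ρ(ℝ_{>0}) ≤ 𝕀_K` (**definition**, the range of `posRealIdele`), `normOneRetraction K`
  (**definition**: a choice of the retraction of `IdeleClassGroup.exists_normOneRetraction`) and its properties;
  `posRealIdeles_eq_ker` (`M = ker r`), `isClosed_posRealIdeles`, `isClosed_normOneIdeles`;
* `ideleSplitEquiv K : 𝕀_K ≃ₜ* 𝕀_K¹ × M` (**definition**), `x ↦ (r x, (r x)⁻¹ x)` with inverse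
  `(b, t) ↦ b t` — **`𝕀_K` is the topological direct product `𝕀_K¹ × M`**;
* `exists_lintegral_ideleGroup_eq_mul_lintegral_lintegral` (**main**) — **for Haar measures `ν` on `𝕀_K`,
  `β` on `𝕀_K¹` and `α` on `M` there is `κ > 0` with
  `∫_{𝕀_K} F dν = κ ∫_M ∫_{𝕀_K¹} F(b t) dβ(b) dα(t)` for every measurable `F ≥ 0`** (uniqueness of Haar
  measure on the second countable locally compact group `𝕀_K¹ × M`, Mathlib
  `isMulLeftInvariant_eq_smul`, transported along `ideleSplitEquiv`; Tonelli).

Everything is proved; three definitions with bodies. Measurable structures: an abstract Borel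
structure on the idele group (`[MeasurableSpace] [BorelSpace]`, the idiom of `IdelicDyadicUnfolding`),
the subtype structures on the two closed subgroups.

## References

* A. Weil, *Basic Number Theory* (1967), Ch. IV §4, Thm. 5, Cor. 2 and Thm. 6 [WeilBNT1967].
* J. Tate, *Fourier analysis in number fields and Hecke's zeta-functions*, in Cassels–Fröhlich (eds.),
  *Algebraic Number Theory* (1967), Ch. XV, §4.3 [CasselsFrohlichANT1967].
-/

noncomputable section

open MeasureTheory Measure Set Filter Topology IsDedekindDomain NumberField
open scoped ENNReal NNReal

namespace Literature.NumberTheory.Automorphic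

open Literature.NumberTheory.GaloisRepresentations (ideleGroup)

variable (K : Type) [Field K] [NumberField K]

/-! ### The split component `M = ρ(ℝ_{>0})` and the retraction onto `𝕀_K¹` -/

/-- **The split component `M = ρ(ℝ_{>0}) ≤ 𝕀_K`**: the diagonal positive real ideles at the archimedean
places (the range of `posRealIdele`; Weil's `M`). [cite: WeilBNT1967, Ch. IV §4 Cor. 2 of Thm. 5] -/
def posRealIdeles : Subgroup (ideleGroup K) := (posRealIdele K).range

/-- `ρ(t) ∈ M`. [folklore] -/
theorem posRealIdele_mem_posRealIdeles (t : ℝ≥0ˣ) : posRealIdele K t ∈ posRealIdeles K := ⟨t, rfl⟩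

/-- **The retraction `r : 𝕀_K →* 𝕀_K¹`**, `r(x) = x θ(x)⁻¹` with `θ(x) = ρ(|x|_𝔸^{1/[K:ℚ]})` (a choice of
the homomorphism of `IdeleClassGroup.exists_normOneRetraction`: continuous, norm-one valued, the identity on `𝕀_K¹`,
trivial on `M`, with `r(x)⁻¹ x ∈ M`). [cite: WeilBNT1967, Ch. IV §4 Cor. 2 of Thm. 5] -/
def normOneRetraction : ideleGroup K →* ideleGroup K := (IdeleClassGroup.exists_normOneRetraction K).choose

/-- `r` is continuous. [folklore] -/
theorem continuous_normOneRetraction : Continuous (normOneRetraction K) :=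
  (IdeleClassGroup.exists_normOneRetraction K).choose_spec.1

/-- `|r(x)|_𝔸 = 1`. [folklore] -/
theorem ideleNorm_normOneRetraction (x : ideleGroup K) :
    IdeleClassGroup.ideleNorm K (normOneRetraction K x) = 1 :=
  (IdeleClassGroup.exists_normOneRetraction K).choose_spec.2.1 x

/-- `r(x) ∈ 𝕀_K¹`. [folklore] -/
theorem normOneRetraction_mem (x : ideleGroup K) : normOneRetraction K x ∈ normOneIdeles K :=
  mem_normOneIdeles.2 (ideleNorm_normOneRetraction K x)

/-- `r` is the identity on `𝕀_K¹`. [folklore] -/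
theorem normOneRetraction_eq_self {x : ideleGroup K} (hx : IdeleClassGroup.ideleNorm K x = 1) :
    normOneRetraction K x = x :=
  (IdeleClassGroup.exists_normOneRetraction K).choose_spec.2.2.1 x hx

/-- `r` is trivial on `M`: `r(ρ(t)) = 1`. [folklore] -/
theorem normOneRetraction_posRealIdele (t : ℝ≥0ˣ) : normOneRetraction K (posRealIdele K t) = 1 :=
  (IdeleClassGroup.exists_normOneRetraction K).choose_spec.2.2.2.1 t

/-- `r(x)⁻¹ x ∈ M`. [folklore] -/
theorem normOneRetraction_inv_mul_mem (x : ideleGroup K) :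
    (normOneRetraction K x)⁻¹ * x ∈ posRealIdeles K :=
  (IdeleClassGroup.exists_normOneRetraction K).choose_spec.2.2.2.2 x

/-- `r` is trivial on `M` (subgroup form). [folklore] -/
theorem normOneRetraction_eq_one_of_mem {t : ideleGroup K} (ht : t ∈ posRealIdeles K) :
    normOneRetraction K t = 1 := by
  obtain ⟨s, rfl⟩ := ht
  exact normOneRetraction_posRealIdele K s

/-- **`M = ker r`**: an idele lies in `ρ(ℝ_{>0})` iff the retraction kills it (`x = r(x) · (r(x)⁻¹ x)`).
[folklore] -/
theorem posRealIdeles_eq_ker : posRealIdeles K = (normOneRetraction K).ker := by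
  ext x
  constructor
  · intro hx
    exact normOneRetraction_eq_one_of_mem K hx
  · intro hx
    rw [MonoidHom.mem_ker] at hx
    have h := normOneRetraction_inv_mul_mem K x
    rwa [hx, inv_one, one_mul] at h

/-- `M` is closed in `𝕀_K` (the kernel of the continuous `r`; `𝕀_K` is Hausdorff). [folklore] -/
theorem isClosed_posRealIdeles : IsClosed (posRealIdeles K : Set (ideleGroup K)) := by
  haveI := t2Space_ideleGroup K
  rw [posRealIdeles_eq_ker]
  exact isClosed_singleton.preimage (continuous_normOneRetraction K)

/-- `𝕀_K¹` is closed in `𝕀_K` (the kernel of the continuous idele norm). [folklore] -/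
theorem isClosed_normOneIdeles : IsClosed (normOneIdeles K : Set (ideleGroup K)) := by
  have h : (normOneIdeles K : Set (ideleGroup K)) = IdeleClassGroup.ideleNorm K ⁻¹' {1} := by
    ext x; simp [mem_normOneIdeles]
  rw [h]
  exact isClosed_singleton.preimage (continuous_ideleNorm_holds K)

/-! ### The splitting `𝕀_K ≃ₜ* 𝕀_K¹ × M` -/

/-- **Weil's splitting `𝕀_K = 𝕀_K¹ × M`** as an isomorphism of topological groups:
`x ↦ (r(x), r(x)⁻¹ x)` with inverse `(b, t) ↦ b t` (`𝕀_K` is commutative; `r` is a continuous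
retraction onto `𝕀_K¹` with kernel `M`). [cite: WeilBNT1967, Ch. IV §4 Cor. 2 of Thm. 5] -/
def ideleSplitEquiv : ideleGroup K ≃ₜ* ↥(normOneIdeles K) × ↥(posRealIdeles K) where
  toFun x := (⟨normOneRetraction K x, normOneRetraction_mem K x⟩,
    ⟨(normOneRetraction K x)⁻¹ * x, normOneRetraction_inv_mul_mem K x⟩)
  invFun p := (p.1 : ideleGroup K) * (p.2 : ideleGroup K)
  left_inv x := by
    change normOneRetraction K x * ((normOneRetraction K x)⁻¹ * x) = x
    rw [mul_inv_cancel_left]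
  right_inv p := by
    obtain ⟨⟨b, hb⟩, ⟨t, ht⟩⟩ := p
    have hrb : normOneRetraction K b = b := normOneRetraction_eq_self K (mem_normOneIdeles.1 hb)
    have hrt : normOneRetraction K t = 1 := normOneRetraction_eq_one_of_mem K ht
    have hr : normOneRetraction K (b * t) = b := by rw [map_mul, hrb, hrt, mul_one]
    refine Prod.ext (Subtype.ext hr) (Subtype.ext ?_)
    change (normOneRetraction K (b * t))⁻¹ * (b * t) = t
    rw [hr, inv_mul_cancel_left]
  map_mul' x y := by
    refine Prod.ext (Subtype.ext (map_mul (normOneRetraction K) x y)) (Subtype.ext ?_)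
    change (normOneRetraction K (x * y))⁻¹ * (x * y) =
      (normOneRetraction K x)⁻¹ * x * ((normOneRetraction K y)⁻¹ * y)
    rw [map_mul, mul_inv]
    simp only [mul_assoc, mul_left_comm, mul_comm]
  continuous_toFun := by
    refine Continuous.prodMk ?_ ?_
    · exact (continuous_normOneRetraction K).subtype_mk _
    · exact ((continuous_normOneRetraction K).inv.mul continuous_id).subtype_mk _
  continuous_invFun := (continuous_subtype_val.comp continuous_fst).mul (continuous_subtype_val.comp continuous_snd)

/-- The inverse of the splitting is multiplication: `(b, t) ↦ b t` (definitional). [folklore] -/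
@[simp]
theorem ideleSplitEquiv_symm_apply (p : ↥(normOneIdeles K) × ↥(posRealIdeles K)) :
    (ideleSplitEquiv K).symm p = (p.1 : ideleGroup K) * (p.2 : ideleGroup K) := rfl

/-- The first component of the splitting is the retraction `r`. [folklore] -/
@[simp]
theorem ideleSplitEquiv_apply_fst (x : ideleGroup K) :
    (((ideleSplitEquiv K x).1 : ↥(normOneIdeles K)) : ideleGroup K) = normOneRetraction K x := rfl

/-- The second component of the splitting is `r(x)⁻¹ x ∈ M`. [folklore] -/
@[simp]
theorem ideleSplitEquiv_apply_snd (x : ideleGroup K) :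
    (((ideleSplitEquiv K x).2 : ↥(posRealIdeles K)) : ideleGroup K) = (normOneRetraction K x)⁻¹ * x := rfl

/-! ### Haar measure: `dν = κ · dβ ⊗ dα` -/

section Haar

variable [MeasurableSpace (ideleGroup K)] [BorelSpace (ideleGroup K)]

omit [MeasurableSpace (ideleGroup K)] [BorelSpace (ideleGroup K)] in
/-- `𝕀_K¹` is locally compact (a closed subgroup of the locally compact `𝕀_K`). [folklore] -/
theorem locallyCompactSpace_normOneIdeles : LocallyCompactSpace ↥(normOneIdeles K) := by
  haveI := locallyCompactSpace_ideleGroup K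
  exact (isClosed_normOneIdeles K).isClosedEmbedding_subtypeVal.locallyCompactSpace

omit [MeasurableSpace (ideleGroup K)] [BorelSpace (ideleGroup K)] in
/-- `M` is locally compact (a closed subgroup of the locally compact `𝕀_K`). [folklore] -/
theorem locallyCompactSpace_posRealIdeles : LocallyCompactSpace ↥(posRealIdeles K) := by
  haveI := locallyCompactSpace_ideleGroup K
  exact (isClosed_posRealIdeles K).isClosedEmbedding_subtypeVal.locallyCompactSpace

/-- **The Haar measure of `𝕀_K` is `κ · dβ ⊗ dα` along the splitting.** For Haar measures `ν` on
`𝕀_K`, `β` on `𝕀_K¹` and `α` on `M = ρ(ℝ_{>0})` there is `κ > 0` with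

  `∫_{𝕀_K} F dν = κ ∫_M ∫_{𝕀_K¹} F(b t) dβ(b) dα(t)`

for every measurable `F ≥ 0` on `𝕀_K` (Haar uniqueness on the second countable locally compact group
`𝕀_K¹ × M`, Mathlib `isMulLeftInvariant_eq_smul`, transported along `ideleSplitEquiv`; Tonelli) —
Tate's "`d*a = d*b · dt/t`" on `J = J¹ × T` (Cassels–Fröhlich XV §4.3), Weil IV §4.
[cite: CasselsFrohlichANT1967, Ch. XV §4.3] -/
theorem exists_lintegral_ideleGroup_eq_mul_lintegral_lintegral
    (ν : Measure (ideleGroup K)) [ν.IsHaarMeasure]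
    (β : Measure ↥(normOneIdeles K)) [β.IsHaarMeasure]
    (α : Measure ↥(posRealIdeles K)) [α.IsHaarMeasure] :
    ∃ κ : ℝ≥0, 0 < κ ∧ ∀ F : ideleGroup K → ℝ≥0∞, Measurable F →
      ∫⁻ x, F x ∂ν = κ * ∫⁻ t, ∫⁻ b, F ((b : ideleGroup K) * (t : ideleGroup K)) ∂β ∂α := by
  haveI := locallyCompactSpace_ideleGroup K
  haveI := secondCountableTopology_ideleGroup K
  haveI := t2Space_ideleGroup K
  haveI := locallyCompactSpace_normOneIdeles K
  haveI := locallyCompactSpace_posRealIdeles K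
  haveI : BorelSpace ↥(normOneIdeles K) := Subtype.borelSpace _
  haveI : BorelSpace ↥(posRealIdeles K) := Subtype.borelSpace _
  haveI : SecondCountableTopology ↥(normOneIdeles K) := TopologicalSpace.Subtype.secondCountableTopology _
  haveI : SecondCountableTopology ↥(posRealIdeles K) := TopologicalSpace.Subtype.secondCountableTopology _
  haveI : BorelSpace (↥(normOneIdeles K) × ↥(posRealIdeles K)) := Prod.borelSpace
  set e := ideleSplitEquiv K with he
  set π : Measure (↥(normOneIdeles K) × ↥(posRealIdeles K)) := β.prod α with hπ
  haveI : π.IsHaarMeasure := by rw [hπ]; infer_instance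
  set ν' := Measure.map e ν with hν'
  haveI : ν'.IsHaarMeasure := e.toMulEquiv.isHaarMeasure_map ν e.continuous e.symm.continuous
  set κ : ℝ≥0 := ν'.haarScalarFactor π with hκ
  have hν'π : ν' = κ • π := isMulLeftInvariant_eq_smul ν' π
  refine ⟨κ, haarScalarFactor_pos_of_isHaarMeasure ν' π, fun F hF => ?_⟩
  set em : ideleGroup K ≃ᵐ ↥(normOneIdeles K) × ↥(posRealIdeles K) :=
    e.toHomeomorph.toMeasurableEquiv with hem
  have hem' : (em : _ → _) = e := rfl
  have hG : Measurable fun p : ↥(normOneIdeles K) × ↥(posRealIdeles K) => F (e.symm p) :=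
    hF.comp e.symm.continuous.measurable
  -- transport to `𝕀_K¹ × M`
  have h1 : ∫⁻ p, F (e.symm p) ∂ν' = ∫⁻ x, F x ∂ν := by
    rw [hν', ← hem', lintegral_map_equiv]
    refine lintegral_congr fun x => ?_
    rw [hem', ContinuousMulEquiv.symm_apply_apply]
  rw [← h1, hν'π, lintegral_smul_measure, hπ, lintegral_prod_symm _ hG.aemeasurable]
  rfl

end Haar

end Literature.NumberTheory.Automorphic
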